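import Literature.MathematicalPhysics.QuantumFieldTheory.VillainCoboundaryMatrix
import Literature.MathematicalPhysics.QuantumFieldTheory.CubicalCochainsBoxThree
import HarnessLib

/-!
# The flux map of the Villain model on a cube with general coefficients: kernel (pure gauge) and
# range (closed 3-cochains), over `ℤ` and over `ℝ`

Support file for the Coulomb-gas (monopole) representation of four-dimensional `U(1)` lattice gauge
theory with the Villain action (proof programme of the named fact
`Literature.MathematicalPhysics.QuantumFieldTheory.FrohlichSpencerU1PerimeterLawD4` and of its
corollary `Literature.Barriers.QuantumFields.AbelianDeconfinementD4`). `VillainFibre` treats the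
integer flux map `m ↦ dm` (plaquette fields of `B_n` → fields on its cubes) and its kernel; the
spin-wave/monopole split of the dual model (FS82 §2.5–2.6) needs the same over `ℝ` (the exact real
plaquette fields `dθ̃` are the kernel of the real flux map) and the RANGE: a field `q` on the cubes
is a flux iff it is closed on the 4-cells of the cube (`dq = 0`), over `ℤ` as over `ℝ` — by the
relative Poincaré lemma in degree three (`CubicalCochainsBoxThree`). With coefficients in any
abelian group `A`:

* `extFreeA`, `dFreeA : (FIdx → A) →+ (PIdx → A)`, `extPlaqA`, `fluxMapA : (PIdx → A) →+ (CIdx → A)`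
  (`CIdx d n` the cubes of `B_n`), `fluxMapA_dFreeA = 0`,
  `exists_dFreeA_eq_of_fluxMapA_eq_zero` (kernel = pure gauge; `CubicalCochainsBoxTwo`);
* `extCubeA`, `IsClosedFlux q` (`cd₃ = 0` on the 4-cells of `B_n`), `isClosedFlux_fluxMapA`
  (`d ∘ d = 0`) and `exists_eq_fluxMapA_of_isClosedFlux` (range = closed fields;
  `CubicalCochainsBoxThree`);
* specialisations: `dFreeA = dFree`/`fluxMapA = fluxMap` over `ℤ` (`VillainFibre`), `dFreeA = dFreeR`
  over `ℝ` (`VillainCoboundaryMatrix`), the real flux map `fluxMapR` as a linear map with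
  `ker_fluxMapR_eq_range_dFreeR`, and `fluxMapR_intCast` (integer fluxes are real fluxes of the
  cast field); consequently an integer cube field in the real range of the flux map is an integer
  flux (`exists_eq_fluxMap_of_mem_range_fluxMapR`: no torsion).

Everything is proved; no named fact is introduced.

## References

* J. Fröhlich, T. Spencer, Comm. Math. Phys. 83 (1982) 411–454, §2.4 (2.21)–(2.24), §2.6
  (2.43)–(2.44). [FrohlichSpencerCMP1982]
-/

noncomputable section

open Finset Function
open Literature.Probability.LatticeModels

namespace Literature.MathematicalPhysics.QuantumFieldTheory

/-- Sites of `ℤ^d` (the namespace-local `Site` is the torus one). -/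
local notation "ZSite" => Literature.Probability.LatticeModels.Site

namespace VillainAngle

open AxialGauge LatticeForm LatticeChain VillainFibre

variable {d n : ℕ}

variable (d n) in
/-- The cubes of `B_n` as an index type. [folklore] -/
abbrev CIdx : Type := ↥(cubesIn (halfOpenBox d n))

section General

variable {A : Type*} [AddCommGroup A]

/-! ### Extensions and the two maps with general coefficients -/

/-- Extension of a free link field by `0` (comb gauge). [folklore] -/
def extFreeA (ℓ : FIdx d n → A) : ZSite d → Fin d → A := fun x i =>
  if h : (x, i) ∈ boxEdges d n then (if hc : IsComb (x, i) then 0 else ℓ ⟨⟨(x, i), h⟩, hc⟩) else 0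

/-- `extFreeA` is additive. [folklore] -/
theorem extFreeA_add (ℓ ℓ' : FIdx d n → A) : extFreeA (ℓ + ℓ') = extFreeA ℓ + extFreeA ℓ' := by
  funext x i; simp only [extFreeA, Pi.add_apply]; split_ifs <;> simp

/-- `extFreeA ℓ` on a free edge. [folklore] -/
theorem extFreeA_apply (ℓ : FIdx d n → A) (e : FIdx d n) : extFreeA ℓ e.1.1.1 e.1.1.2 = ℓ e := by
  obtain ⟨⟨⟨x, i⟩, h⟩, hc⟩ := e
  simp [extFreeA, h, hc]

/-- `extFreeA ℓ` is in the comb gauge based at `0`. [folklore] -/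
theorem extFreeA_comb (ℓ : FIdx d n → A) (x : ZSite d) (i : Fin d)
    (hx : ∀ m : Fin d, i.val < m.val → x m = (0 : ZSite d) m) : extFreeA ℓ x i = 0 := by
  simp only [extFreeA]
  split_ifs with h hc
  · rfl
  · exact absurd (fun k hk => hx k hk) hc
  · rfl

/-- `d₁` is additive. [folklore] -/
theorem d₁_add' (θ θ' : ZSite d → Fin d → A) : d₁ (θ + θ') = d₁ θ + d₁ θ' := by
  funext x i j; simp only [d₁, Pi.add_apply]; abel

/-- `d₂` is additive. [folklore] -/
theorem d₂_add' (ω ω' : ZSite d → Fin d → Fin d → A) : d₂ (ω + ω') = d₂ ω + d₂ ω' := by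
  funext x i j k; simp only [d₂, Pi.add_apply]; abel

/-- The coboundary of a free link field on the plaquettes of `B_n`. [folklore] -/
def dFreeA : (FIdx d n → A) →+ (PIdx d n → A) where
  toFun ℓ p := d₁ (extFreeA ℓ) p.1.1 p.1.2.1 p.1.2.2
  map_zero' := by
    funext p
    have : extFreeA (0 : FIdx d n → A) = 0 := by funext x i; simp [extFreeA]
    simp [this, d₁]
  map_add' ℓ ℓ' := by funext p; simp [extFreeA_add, d₁_add']

/-- Unfolding `dFreeA`. [folklore] -/
theorem dFreeA_apply (ℓ : FIdx d n → A) (p : PIdx d n) :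
    dFreeA ℓ p = d₁ (extFreeA ℓ) p.1.1 p.1.2.1 p.1.2.2 := rfl

/-- Extension of a plaquette field of `B_n` by `0`. [folklore] -/
def extPlaqA (m : PIdx d n → A) : ZSite d → Fin d → Fin d → A :=
  fun x i j => if h : (x, i, j) ∈ plaquettesIn (halfOpenBox d n) then m ⟨(x, i, j), h⟩ else 0

/-- `extPlaqA` is additive. [folklore] -/
theorem extPlaqA_add (m m' : PIdx d n → A) : extPlaqA (m + m') = extPlaqA m + extPlaqA m' := by
  funext x i j; simp only [extPlaqA, Pi.add_apply]; split_ifs <;> simp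

/-- `extPlaqA m` on a plaquette of `B_n`. [folklore] -/
theorem extPlaqA_apply (m : PIdx d n → A) {x : ZSite d} {i j : Fin d}
    (h : (x, i, j) ∈ plaquettesIn (halfOpenBox d n)) : extPlaqA m x i j = m ⟨(x, i, j), h⟩ := by
  simp [extPlaqA, h]

/-- The flux map with coefficients in `A`: `q = dm` on the cubes of `B_n`. [cite: FrohlichSpencerCMP1982, §2.4 (2.21)–(2.22)] -/
def fluxMapA : (PIdx d n → A) →+ (CIdx d n → A) where
  toFun m c := d₂ (extPlaqA m) c.1.1 c.1.2.1 c.1.2.2.1 c.1.2.2.2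
  map_zero' := by
    funext c
    have : extPlaqA (0 : PIdx d n → A) = 0 := by funext x i j; simp [extPlaqA]
    simp [this, d₂]
  map_add' m m' := by funext c; simp [extPlaqA_add, d₂_add']

/-- Unfolding `fluxMapA`. [folklore] -/
theorem fluxMapA_apply (m : PIdx d n → A) (c : CIdx d n) :
    fluxMapA m c = d₂ (extPlaqA m) c.1.1 c.1.2.1 c.1.2.2.1 c.1.2.2.2 := rfl

/-- `d₂` at a cube of `B_n` only reads the plaquettes of `B_n`. [folklore] -/
theorem d₂_congr_of_eqOn' {ω ω' : ZSite d → Fin d → Fin d → A}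
    (h : ∀ x i j, (x, i, j) ∈ plaquettesIn (halfOpenBox d n) → ω x i j = ω' x i j)
    {x : ZSite d} {i j k : Fin d} (hc : (x, i, j, k) ∈ cubesIn (halfOpenBox d n)) :
    d₂ ω x i j k = d₂ ω' x i j k := by
  obtain ⟨h1, h2, h3, h4, h5, h6⟩ := faces_mem hc
  simp only [d₂, h _ _ _ h1, h _ _ _ h2, h _ _ _ h3, h _ _ _ h4, h _ _ _ h5, h _ _ _ h6]

/-- **Pure gauge carries no flux**: `fluxMapA (dFreeA ℓ) = 0`. [folklore] -/
theorem fluxMapA_dFreeA (ℓ : FIdx d n → A) : fluxMapA (dFreeA ℓ) = 0 := by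
  funext c
  obtain ⟨⟨x, i, j, k⟩, hc⟩ := c
  rw [fluxMapA_apply, Pi.zero_apply]
  have : d₂ (extPlaqA (dFreeA ℓ)) x i j k = d₂ (d₁ (extFreeA ℓ)) x i j k :=
    d₂_congr_of_eqOn' (fun y a b hy => by rw [extPlaqA_apply _ hy]; rfl) hc
  rw [this, d₂_d₁]
  rfl

/-- `d₁` at a plaquette only reads its four edges. [folklore] -/
theorem d₁_congr' {θ θ' : ZSite d → Fin d → A} {x : ZSite d} {i j : Fin d}
    (h1 : θ x i = θ' x i) (h2 : θ (x + e i) j = θ' (x + e i) j) (h3 : θ (x + e j) i = θ' (x + e j) i)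
    (h4 : θ x j = θ' x j) : d₁ θ x i j = d₁ θ' x i j := by
  simp only [d₁, h1, h2, h3, h4]

/-- **The kernel of the flux map is the pure gauge** (relative Poincaré lemma in degree two,
`CubicalCochainsBoxTwo`, in the comb gauge). [cite: FrohlichSpencerCMP1982, §2.4 (2.22)] -/
theorem exists_dFreeA_eq_of_fluxMapA_eq_zero (m : PIdx d n → A) (hm : fluxMapA m = 0) :
    ∃ ℓ : FIdx d n → A, dFreeA ℓ = m := by
  classical
  set ω := extPlaqA m with hω
  have hcl : ∀ (x : ZSite d) (i j k : Fin d), i.val < j.val → j.val < k.val →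
      x ∈ Set.Icc (0 : ZSite d) (top d n) → x + e i + e j + e k ∈ Set.Icc (0 : ZSite d) (top d n) →
      d₂ ω x i j k = 0 := by
    intro x i j k hij hjk hx hxijk
    have hc : (x, i, j, k) ∈ cubesIn (halfOpenBox d n) :=
      mem_cubesIn_of_corners (Fin.lt_def.2 hij) (Fin.lt_def.2 hjk) (mem_halfOpenBox_iff_mem_Icc.2 hx)
        (mem_halfOpenBox_iff_mem_Icc.2 hxijk)
    have := congrFun hm ⟨(x, i, j, k), hc⟩
    rwa [fluxMapA_apply, Pi.zero_apply] at this
  have hθ := exists_d₁_eq_of_closed_on_box ω 0 (top d n) hcl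
  set θ := boxPrim₂ ω 0 d with hθdef
  refine ⟨fun e => θ e.1.1.1 e.1.1.2, ?_⟩
  have hagree : ∀ (y : ZSite d) (a : Fin d), (y, a) ∈ boxEdges d n →
      extFreeA (fun e : FIdx d n => θ e.1.1.1 e.1.1.2) y a = θ y a := by
    intro y a hya
    by_cases hc : IsComb (y, a)
    · rw [extFreeA_comb _ y a (fun m hm => hc m (Fin.lt_def.2 hm))]
      exact (boxPrim₂_comb ω 0 d le_rfl y a fun m hm => hc m (Fin.lt_def.2 hm)).symm
    · simp [extFreeA, hya, hc]
  funext p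
  obtain ⟨⟨x, i, j⟩, hp⟩ := p
  obtain ⟨h1, h2, h3, h4⟩ := edges_mem_boxEdges hp
  obtain ⟨hij, hx, hxij⟩ := mem_plaquettesIn_iff.1 hp
  rw [dFreeA_apply]
  simp only
  rw [d₁_congr' (hagree _ _ h1) (hagree _ _ h2) (hagree _ _ h3) (hagree _ _ h4),
    hθ x i j (Fin.lt_def.1 hij) (mem_halfOpenBox_iff_mem_Icc.1 hx) (mem_halfOpenBox_iff_mem_Icc.1 hxij),
    hω, extPlaqA_apply m hp]

/-! ### The range of the flux map: closed fields on the cubes -/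

/-- Extension of a cube field of `B_n` by `0` (as a 3-cochain on the increasing triples). [folklore] -/
def extCubeA (q : CIdx d n → A) : ZSite d → Fin d → Fin d → Fin d → A :=
  fun x i j k => if h : (x, i, j, k) ∈ cubesIn (halfOpenBox d n) then q ⟨(x, i, j, k), h⟩ else 0

/-- `extCubeA q` on a cube of `B_n`. [folklore] -/
theorem extCubeA_apply (q : CIdx d n → A) {x : ZSite d} {i j k : Fin d}
    (h : (x, i, j, k) ∈ cubesIn (halfOpenBox d n)) : extCubeA q x i j k = q ⟨(x, i, j, k), h⟩ := by
  simp [extCubeA, h]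

/-- **Closed cube fields**: `dq = 0` on the 4-cells of `B_n` (`x`, `x + eᵢ + eⱼ + e_k + e_l ∈ B_n`,
`i < j < k < l`). [cite: FrohlichSpencerCMP1982, §2.6 (2.43)–(2.44) (δρ = 0)] -/
def IsClosedFlux (q : CIdx d n → A) : Prop :=
  ∀ (x : ZSite d) (i j k l : Fin d), i.val < j.val → j.val < k.val → k.val < l.val →
    x ∈ halfOpenBox d n → x + e i + e j + e k + e l ∈ halfOpenBox d n → cd₃ (extCubeA q) x i j k l = 0

/-- The eight cubes of a 4-cell of `B_n` are cubes of `B_n`. [folklore] -/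
theorem cubes_mem_of_fourCell {x : ZSite d} {i j k l : Fin d} (hij : i < j) (hjk : j < k) (hkl : k < l)
    (hx : x ∈ halfOpenBox d n) (hx4 : x + e i + e j + e k + e l ∈ halfOpenBox d n) :
    (x, j, k, l) ∈ cubesIn (halfOpenBox d n) ∧ (x + e i, j, k, l) ∈ cubesIn (halfOpenBox d n) ∧
    (x, i, k, l) ∈ cubesIn (halfOpenBox d n) ∧ (x + e j, i, k, l) ∈ cubesIn (halfOpenBox d n) ∧
    (x, i, j, l) ∈ cubesIn (halfOpenBox d n) ∧ (x + e k, i, j, l) ∈ cubesIn (halfOpenBox d n) ∧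
    (x, i, j, k) ∈ cubesIn (halfOpenBox d n) ∧ (x + e l, i, j, k) ∈ cubesIn (halfOpenBox d n) := by
  have hik : i < k := hij.trans hjk
  have hil : i < l := hik.trans hkl
  have hjl : j < l := hjk.trans hkl
  have hne : ∀ {a b : Fin d}, a < b → a ≠ b := fun h => h.ne
  -- every corner `y` with `x ≤ y ≤ x + eᵢ + eⱼ + e_k + e_l` is in the box
  have corner : ∀ y : ZSite d, (∀ m, x m ≤ y m ∧ y m ≤ (x + e i + e j + e k + e l) m) →
      y ∈ halfOpenBox d n := fun y hy => mem_halfOpenBox_of_between hx hx4 hy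
  have tac : ∀ (y : ZSite d), (∀ m, x m ≤ y m ∧ y m ≤ (x + e i + e j + e k + e l) m) →
      ∀ (a b c : Fin d), a < b → b < c →
      (∀ m, x m ≤ (y + e a + e b + e c) m ∧ (y + e a + e b + e c) m ≤ (x + e i + e j + e k + e l) m) →
      (y, a, b, c) ∈ cubesIn (halfOpenBox d n) :=
    fun y hy a b c hab hbc hy' => mem_cubesIn_of_corners hab hbc (corner y hy) (corner _ hy')
  refine ⟨tac _ ?_ _ _ _ hjk hkl ?_, tac _ ?_ _ _ _ hjk hkl ?_, tac _ ?_ _ _ _ hik hkl ?_,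
    tac _ ?_ _ _ _ hik hkl ?_, tac _ ?_ _ _ _ hij hjl ?_, tac _ ?_ _ _ _ hij hjl ?_,
    tac _ ?_ _ _ _ hij hjk ?_, tac _ ?_ _ _ _ hij hjk ?_⟩
  all_goals
    intro m
    have h1 := hne hij; have h2 := hne hjk; have h3 := hne hkl; have h4 := hne hik
    have h5 := hne hil; have h6 := hne hjl
    simp only [Pi.add_apply, LatticeForm.e, Pi.single_apply]
    split_ifs <;> omega

/-- **Fluxes are closed**: `d(dm) = 0` on the 4-cells of `B_n`. [cite: FrohlichSpencerCMP1982, §2.3 (2.13)] -/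
theorem isClosedFlux_fluxMapA (m : PIdx d n → A) : IsClosedFlux (fluxMapA m) := by
  intro x i j k l hij hjk hkl hx hx4
  obtain ⟨c1, c2, c3, c4, c5, c6, c7, c8⟩ :=
    cubes_mem_of_fourCell (Fin.lt_def.2 hij) (Fin.lt_def.2 hjk) (Fin.lt_def.2 hkl) hx hx4
  have hrepl : ∀ {y : ZSite d} {a b c : Fin d} (h : (y, a, b, c) ∈ cubesIn (halfOpenBox d n)),
      extCubeA (fluxMapA m) y a b c = d₂ (extPlaqA m) y a b c := fun h => by
    rw [extCubeA_apply _ h]; rfl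
  have h0 := congrFun (congrFun (congrFun (congrFun (congrFun (cd₃_d₂ (extPlaqA m)) x) i) j) k) l
  simp only [Pi.zero_apply] at h0
  simp only [cd₃, hrepl c1, hrepl c2, hrepl c3, hrepl c4, hrepl c5, hrepl c6, hrepl c7, hrepl c8]
  simpa only [cd₃] using h0

/-- **Closed cube fields are fluxes** (relative Poincaré lemma in degree three,
`CubicalCochainsBoxThree`): if `dq = 0` on the 4-cells of `B_n` then `q = fluxMapA m` for a
plaquette field `m` with coefficients in the same group. [cite: FrohlichSpencerCMP1982, §2.3 Lemma 1, §2.6 (2.43)–(2.44)] -/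
theorem exists_eq_fluxMapA_of_isClosedFlux (q : CIdx d n → A) (hq : IsClosedFlux q) :
    ∃ m : PIdx d n → A, fluxMapA m = q := by
  classical
  set Q := extCubeA q with hQ
  have hcl : ∀ (x : ZSite d) (i j k l : Fin d), i.val < j.val → j.val < k.val → k.val < l.val →
      x ∈ Set.Icc (0 : ZSite d) (top d n) → x + e i + e j + e k + e l ∈ Set.Icc (0 : ZSite d) (top d n) →
      cd₃ Q x i j k l = 0 :=
    fun x i j k l hij hjk hkl hx hx4 =>
      hq x i j k l hij hjk hkl (mem_halfOpenBox_iff_mem_Icc.2 hx) (mem_halfOpenBox_iff_mem_Icc.2 hx4)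
  have hω := exists_d₂_eq_of_closed_on_box₃ Q 0 (top d n) hcl
  set ω := boxPrim₃ Q 0 d with hωdef
  refine ⟨fun p => ω p.1.1 p.1.2.1 p.1.2.2, ?_⟩
  funext c
  obtain ⟨⟨x, i, j, k⟩, hc⟩ := c
  obtain ⟨hx, hij, hjk, -, -, -, -, -, -, hxijk⟩ := mem_cubesIn.1 hc
  rw [fluxMapA_apply]
  simp only
  rw [d₂_congr_of_eqOn' (ω' := ω) (fun y a b hy => by rw [extPlaqA_apply _ hy]) hc,
    hω x i j k (Fin.lt_def.1 hij) (Fin.lt_def.1 hjk) (mem_halfOpenBox_iff_mem_Icc.1 hx)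
      (mem_halfOpenBox_iff_mem_Icc.1 hxijk), hQ, extCubeA_apply q hc]

/-- **The range of the flux map is the set of closed cube fields.** [cite: FrohlichSpencerCMP1982, §2.6 (2.43)–(2.44)] -/
theorem mem_range_fluxMapA_iff (q : CIdx d n → A) : q ∈ (fluxMapA (d := d) (n := n) (A := A)).range ↔ IsClosedFlux q :=
  ⟨fun ⟨m, hm⟩ => hm ▸ isClosedFlux_fluxMapA m, fun h => exists_eq_fluxMapA_of_isClosedFlux q h⟩

end General

/-! ### Specialisations: `ℤ` (`VillainFibre`) and `ℝ` (`VillainCoboundaryMatrix`) -/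

/-- Over `ℤ`, `extFreeA = extFree`. [folklore] -/
theorem extFreeA_int (ℓ : FreeInt d n) : extFreeA ℓ = extFree ℓ := rfl

/-- Over `ℤ`, `dFreeA = dFree`. [folklore] -/
theorem dFreeA_int (ℓ : FreeInt d n) : dFreeA ℓ = dFree ℓ := rfl

/-- Over `ℤ`, `fluxMapA = fluxMap`. [folklore] -/
theorem fluxMapA_int (m : PIdx d n → ℤ) : fluxMapA m = fluxMap m := rfl

/-- Over `ℝ`, `extFreeA = extAngle`. [folklore] -/
theorem extFreeA_real (θ : FIdx d n → ℝ) : extFreeA θ = extAngle θ := rfl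

/-- Over `ℝ`, `dFreeA = dFreeR`. [folklore] -/
theorem dFreeA_real (θ : FIdx d n → ℝ) : dFreeA θ = dFreeR θ := rfl

/-- **The real flux map** as a linear map. [cite: FrohlichSpencerCMP1982, §2.4 (2.21)–(2.22)] -/
def fluxMapR : (PIdx d n → ℝ) →ₗ[ℝ] (CIdx d n → ℝ) where
  toFun := fluxMapA
  map_add' := map_add fluxMapA
  map_smul' c m := by
    funext q
    have hext : extPlaqA (c • m) = c • extPlaqA m := by
      funext x i j; simp only [extPlaqA, Pi.smul_apply, smul_eq_mul]; split_ifs <;> simp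
    simp only [fluxMapA_apply, hext, RingHom.id_apply, Pi.smul_apply, smul_eq_mul, d₂]
    ring

/-- `fluxMapR = fluxMapA` as functions. [folklore] -/
theorem fluxMapR_apply (m : PIdx d n → ℝ) : fluxMapR m = fluxMapA m := rfl

/-- **The exact real plaquette fields are the kernel of the real flux map**: `ker fluxMapR = range dFreeR`.
[cite: FrohlichSpencerCMP1982, §2.5 (the split into exact and co-exact parts)] -/
theorem ker_fluxMapR_eq_range_dFreeR :
    LinearMap.ker (fluxMapR (d := d) (n := n)) = LinearMap.range (dFreeR (d := d) (n := n)) := by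
  ext m
  rw [LinearMap.mem_ker, LinearMap.mem_range, fluxMapR_apply]
  constructor
  · intro hm
    obtain ⟨θ, hθ⟩ := exists_dFreeA_eq_of_fluxMapA_eq_zero m hm
    exact ⟨θ, by rw [← dFreeA_real, hθ]⟩
  · rintro ⟨θ, rfl⟩
    rw [← dFreeA_real]
    exact fluxMapA_dFreeA θ

/-- Integer fluxes are real fluxes of the cast field. [folklore] -/
theorem fluxMapA_intCast (m : PIdx d n → ℤ) :
    fluxMapA (fun p => (m p : ℝ)) = fun c => (fluxMap m c : ℝ) := by
  funext c
  rw [fluxMapA_apply, ← fluxMapA_int, fluxMapA_apply]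
  have hext : extPlaqA (fun p : PIdx d n => (m p : ℝ)) = fun x i j => ((extPlaqA m x i j : ℤ) : ℝ) := by
    funext x i j; simp only [extPlaqA]; split_ifs <;> simp
  rw [hext]
  simp only [d₂]
  push_cast
  ring

/-- **No torsion**: an integer cube field which is a real flux is an integer flux (both are the
closed fields, and closedness of an integer field does not depend on the coefficients).
[cite: FrohlichSpencerCMP1982, §2.6 (2.43)–(2.44)] -/
theorem exists_eq_fluxMap_of_mem_range_fluxMapR (q : CIdx d n → ℤ)
    (hq : (fun c => (q c : ℝ)) ∈ LinearMap.range (fluxMapR (d := d) (n := n))) :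
    ∃ m : PIdx d n → ℤ, fluxMap m = q := by
  obtain ⟨mr, hmr⟩ := hq
  rw [fluxMapR_apply] at hmr
  have hclR : IsClosedFlux (fun c => (q c : ℝ)) := hmr ▸ isClosedFlux_fluxMapA mr
  have hclZ : IsClosedFlux q := by
    intro x i j k l hij hjk hkl hx hx4
    have h := hclR x i j k l hij hjk hkl hx hx4
    have hext : extCubeA (fun c : CIdx d n => (q c : ℝ)) = fun y a b c => ((extCubeA q y a b c : ℤ) : ℝ) := by
      funext y a b c; simp only [extCubeA]; split_ifs <;> simp
    rw [hext] at h
    simp only [cd₃] at h ⊢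
    exact_mod_cast h
  obtain ⟨m, hm⟩ := exists_eq_fluxMapA_of_isClosedFlux q hclZ
  exact ⟨m, by rw [← fluxMapA_int, hm]⟩

end VillainAngle

end Literature.MathematicalPhysics.QuantumFieldTheory
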